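import Summits.Ventures.PercRepro.RankLevelSetBiIndepLRSplit

/-! # RankLevelSetBiIndepPerCircuit — THE PER-CIRCUIT REFINEMENT (PC) OF THE NEAR-MIDDLE (★★), AND ITS BRIDGE:
(PC) FOR EVERY CIRCUIT THROUGH `y` IMPLIES (★★) AT THE LAST LEVEL BELOW THE MIDDLE (night-1 g28; dossier §40.7)

For a finite matroid `M` on `n = 2j + 2` elements, `y ∈ E` and a circuit `C ∋ y` put (`E′ = E ∖ {y}`, `C₀ = C ∖ {y}`)
* `ℓ(C) = circuitLowCount M y C j = #{P ⊆ E′ : #P = j, C₀ ⊆ P, P independent, (E′ ∖ P) ∪ {y} independent}`,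
* `ρ(C) = circuitHighCount M y C j = #{R ⊆ E′ : #R = j + 1, C₀ ⊆ R, R independent, (E′ ∖ R) ∪ {y} independent}`.
**(PC)** (`PerCircuitMid M`, a `Prop`, NOT asserted): `ℓ(C) ≤ ρ(C)` for every such `y`, `C`, `j`. Census (night-1 g28, own
exact code): every matroid with ≤ 8 elements, every `y`, every circuit through `y` (161,099 instances at `n = 8`), and —
in the form of the contraction `Q = M / y` — every circuit of every rank-5 matroid on 9 elements (9,675,847 instances):
0 failures. THE BRIDGE: the bi-independent `j`-sets `Z` avoiding `y` split into those with `Z ∪ {y}` independent and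
those with `Z ∪ {y}` dependent; the latter have a UNIQUE circuit of `y` in `Z ∪ {y}` (`fundCircuit`), so they are the
disjoint union over the circuits `C ∋ y` of the `ℓ(C)`-families; the bi-independent `(j+1)`-sets `Q` through `y` split
likewise by `(E ∖ Q) ∪ {y}`, the dependent part being the disjoint union of the `ρ(C)`-families (via `Q ↦ E ∖ Q`); the
two independent parts are in bijection (`Z ↦ Z ∪ {y}`). Hence **`perElemMid_of_perCircuit : PerCircuitMid M →`
`{Z ∈ D_j : y ∉ Z}.ncard ≤ {Q ∈ D_{j+1} : y ∈ Q}.ncard` for `#E = 2j + 2`** — (★★) at the last level below the middle,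
the exact level whose minors give (CD) (`RankLevelSetIndepCD`), now reduced to a statement with NO modular cut: one
matroid, one circuit. Every declaration has a docstring; imports: the cell's own modules and Mathlib only.
Axioms: standard. -/

namespace PercRepro

open Set Matroid Finset

variable {α : Type} (M : Matroid α) [M.Finite]

/-! ## The per-circuit counts and the Prop -/

omit [M.Finite] in
/-- `ℓ(C)`: the bi-independent `j`-sets `P ⊆ E ∖ {y}` containing `C ∖ {y}` whose complement absorbs nothing
(`(E′ ∖ P) ∪ {y}` independent). -/
noncomputable def circuitLowCount (y : α) (C : Set α) (j : ℕ) : ℕ :=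
  {P : Set α | P ⊆ M.E \ {y} ∧ P.ncard = j ∧ C \ {y} ⊆ P ∧ M.Indep P ∧ M.Indep (insert y ((M.E \ {y}) \ P))}.ncard

omit [M.Finite] in
/-- `ρ(C)`: the bi-independent `(j+1)`-sets `R ⊆ E ∖ {y}` containing `C ∖ {y}` whose complement absorbs nothing. -/
noncomputable def circuitHighCount (y : α) (C : Set α) (j : ℕ) : ℕ :=
  {R : Set α | R ⊆ M.E \ {y} ∧ R.ncard = j + 1 ∧ C \ {y} ⊆ R ∧ M.Indep R ∧
    M.Indep (insert y ((M.E \ {y}) \ R))}.ncard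

omit [M.Finite] in
/-- **(PC), the per-circuit refinement of the near-middle (★★)** (a `Prop`, NOT asserted): for every `y ∈ E`, every
circuit `C` through `y` and `#E = 2j + 2`, `ℓ(C) ≤ ρ(C)`. -/
def PerCircuitMid : Prop :=
  ∀ y ∈ M.E, ∀ C : Set α, M.IsCircuit C → y ∈ C → ∀ j : ℕ, M.E.ncard = 2 * j + 2 →
    circuitLowCount M y C j ≤ circuitHighCount M y C j

/-! ## Splitting a finite family by a predicate -/

omit [M.Finite] in
/-- A finite family of sets splits by a predicate. -/
lemma ncard_split_pred (𝒟 : Set (Set α)) (h𝒟 : 𝒟.Finite) (P : Set α → Prop) :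
    𝒟.ncard = {S ∈ 𝒟 | P S}.ncard + {S ∈ 𝒟 | ¬ P S}.ncard := by
  have hfin1 : {S ∈ 𝒟 | P S}.Finite := h𝒟.subset (fun S hS => hS.1)
  have hfin2 : {S ∈ 𝒟 | ¬ P S}.Finite := h𝒟.subset (fun S hS => hS.1)
  have hdisj : Disjoint {S ∈ 𝒟 | P S} {S ∈ 𝒟 | ¬ P S} := by
    rw [Set.disjoint_left]
    rintro S ⟨-, h1⟩ ⟨-, h2⟩
    exact h2 h1
  rw [← Set.ncard_union_eq hdisj hfin1 hfin2]
  congr 1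
  ext S
  simp only [Set.mem_union, Set.mem_setOf_eq]
  tauto

/-! ## The circuits through `y` -/

/-- The circuits of `M` through `y`, as a finite set (they are subsets of the finite ground set). -/
noncomputable def circuitsThrough (y : α) : Finset (Set α) := by
  classical
  exact (M.ground_finite.finite_subsets.toFinset).filter (fun C => M.IsCircuit C ∧ y ∈ C)

/-- Membership in `circuitsThrough`. -/
lemma mem_circuitsThrough {y : α} {C : Set α} : C ∈ circuitsThrough M y ↔ M.IsCircuit C ∧ y ∈ C := by
  classical
  unfold circuitsThrough
  simp only [Finset.mem_filter, Set.Finite.mem_toFinset, Set.mem_setOf_eq]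
  exact ⟨fun h => h.2, fun h => ⟨h.1.subset_ground, h⟩⟩

omit [M.Finite] in
/-- For an independent `I` with `y ∉ I` and `insert y I` dependent, the fundamental circuit of `y` in `I` is a circuit
through `y` contained in `insert y I`. -/
lemma fundCircuit_spec {y : α} {I : Set α} (hI : M.Indep I) (hyI : y ∉ I) (hyE : y ∈ M.E)
    (hdep : ¬ M.Indep (insert y I)) :
    M.IsCircuit (M.fundCircuit y I) ∧ y ∈ M.fundCircuit y I ∧ M.fundCircuit y I ⊆ insert y I := by
  have hcl : y ∈ M.closure I := by
    by_contra hcl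
    exact hdep ((hI.insert_indep_iff_of_notMem hyI).mpr ⟨hyE, hcl⟩)
  exact ⟨hI.fundCircuit_isCircuit hcl hyI, M.mem_fundCircuit y I, M.fundCircuit_subset_insert y I⟩

/-! ## The absorbing `j`-sets avoiding `y` are the disjoint union of the `ℓ(C)`-families -/

/-- The absorbing part of the avoid-`y` family at level `j`: `Z ∈ D_j`, `y ∉ Z`, `insert y Z` dependent. -/
def lowAbsorb (y : α) (j : ℕ) : Set (Set α) :=
  {Z ∈ biIndep M j | y ∉ Z ∧ ¬ M.Indep (insert y Z)}

/-- `lowAbsorb` is finite. -/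
lemma lowAbsorb_finite (y : α) (j : ℕ) : (lowAbsorb M y j).Finite :=
  (biIndep_finite M j).subset (fun _ h => h.1)

omit [M.Finite] in
/-- The complement identity `insert y ((E ∖ {y}) ∖ Z) = E ∖ Z` for `y ∈ E`, `y ∉ Z`. -/
lemma insert_sdiff_sdiff_eq {y : α} {Z : Set α} (hyE : y ∈ M.E) (hyZ : y ∉ Z) :
    insert y ((M.E \ {y}) \ Z) = M.E \ Z := by
  ext x
  simp only [Set.mem_insert_iff, Set.mem_sdiff, Set.mem_singleton_iff]
  constructor
  · rintro (rfl | ⟨⟨hxE, -⟩, hxZ⟩)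
    · exact ⟨hyE, hyZ⟩
    · exact ⟨hxE, hxZ⟩
  · rintro ⟨hxE, hxZ⟩
    by_cases hxy : x = y
    · exact Or.inl hxy
    · exact Or.inr ⟨⟨hxE, hxy⟩, hxZ⟩

omit [M.Finite] in
/-- **The fibre of `lowAbsorb` over a circuit `C` is the `ℓ(C)`-family.** -/
lemma lowAbsorb_fibre_eq {y : α} (hyE : y ∈ M.E) {C : Set α} (hC : M.IsCircuit C) (j : ℕ) :
    {Z ∈ lowAbsorb M y j | M.fundCircuit y Z = C} =
      {P : Set α | P ⊆ M.E \ {y} ∧ P.ncard = j ∧ C \ {y} ⊆ P ∧ M.Indep P ∧ M.Indep (insert y ((M.E \ {y}) \ P))} := by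
  ext Z
  simp only [lowAbsorb, biIndep, Set.mem_setOf_eq]
  constructor
  · rintro ⟨⟨⟨hZE, hZcard, hZind, hZcind⟩, hyZ, hdep⟩, hfund⟩
    refine ⟨?_, hZcard, ?_, hZind, ?_⟩
    · intro x hx
      exact ⟨hZE hx, fun h => hyZ (Set.mem_singleton_iff.mp h ▸ hx)⟩
    · rw [← hfund]
      intro x hx
      rcases Set.mem_insert_iff.mp (M.fundCircuit_subset_insert y Z hx.1) with h | h
      · exact absurd h hx.2
      · exact h
    · rw [insert_sdiff_sdiff_eq M hyE hyZ]; exact hZcind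
  · rintro ⟨hZE, hZcard, hCZ, hZind, hZcind⟩
    have hyZ : y ∉ Z := fun h => (hZE h).2 rfl
    have hCs : C ⊆ insert y Z := by
      intro x hx
      by_cases hxy : x = y
      · exact Or.inl hxy
      · exact Or.inr (hCZ ⟨hx, hxy⟩)
    refine ⟨⟨⟨hZE.trans Set.sdiff_subset, hZcard, hZind, ?_⟩, hyZ, ?_⟩, ?_⟩
    · rw [← insert_sdiff_sdiff_eq M hyE hyZ]; exact hZcind
    · exact fun hind => hC.dep.not_indep (hind.subset hCs)
    · exact (hC.eq_fundCircuit_of_subset hZind hCs).symm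

/-- Every member of `lowAbsorb` has its fundamental circuit among the circuits through `y`. -/
lemma fundCircuit_mem_circuitsThrough {y : α} (hyE : y ∈ M.E) {j : ℕ} {Z : Set α} (hZ : Z ∈ lowAbsorb M y j) :
    M.fundCircuit y Z ∈ circuitsThrough M y := by
  obtain ⟨⟨-, -, hZind, -⟩, hyZ, hdep⟩ := hZ
  rw [mem_circuitsThrough]
  obtain ⟨h1, h2, -⟩ := fundCircuit_spec M hZind hyZ hyE hdep
  exact ⟨h1, h2⟩

/-- **`#lowAbsorb = Σ_{C ∋ y} ℓ(C)`** (fibrewise by the fundamental circuit of `y`). -/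
lemma ncard_lowAbsorb_eq_sum {y : α} (hyE : y ∈ M.E) (j : ℕ) :
    (lowAbsorb M y j).ncard = ∑ C ∈ circuitsThrough M y, circuitLowCount M y C j := by
  classical
  have hfin := lowAbsorb_finite M y j
  rw [Set.ncard_eq_toFinset_card _ hfin]
  rw [Finset.card_eq_sum_card_fiberwise (f := fun Z => M.fundCircuit y Z) (t := circuitsThrough M y)
    (fun Z hZ => fundCircuit_mem_circuitsThrough M hyE (hfin.mem_toFinset.mp hZ))]
  refine Finset.sum_congr rfl (fun C hC => ?_)
  rw [mem_circuitsThrough] at hC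
  unfold circuitLowCount
  rw [← lowAbsorb_fibre_eq M hyE hC.1 j, ← Set.ncard_coe_finset]
  congr 1
  ext Z
  simp only [Finset.coe_filter, Set.Finite.mem_toFinset, Set.mem_setOf_eq]

/-! ## The absorbing `(j+1)`-sets through `y` are the disjoint union of the `ρ(C)`-families -/

/-- The absorbing part of the through-`y` family at level `j + 1`: `Q ∈ D_{j+1}`, `y ∈ Q`, `insert y (E ∖ Q)` dependent. -/
def highAbsorb (y : α) (j : ℕ) : Set (Set α) :=
  {Q ∈ biIndep M (j + 1) | y ∈ Q ∧ ¬ M.Indep (insert y (M.E \ Q))}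

/-- `highAbsorb` is finite. -/
lemma highAbsorb_finite (y : α) (j : ℕ) : (highAbsorb M y j).Finite :=
  (biIndep_finite M (j + 1)).subset (fun _ h => h.1)

/-- **The fibre of `highAbsorb` over a circuit `C` has the size of the `ρ(C)`-family** (by `Q ↦ E ∖ Q`). -/
lemma ncard_highAbsorb_fibre {y : α} (hyE : y ∈ M.E) {C : Set α} (hC : M.IsCircuit C) {j : ℕ}
    (hn : M.E.ncard = 2 * j + 2) :
    {Q ∈ highAbsorb M y j | M.fundCircuit y (M.E \ Q) = C}.ncard = circuitHighCount M y C j := by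
  unfold circuitHighCount
  refine Set.ncard_congr (fun Q _ => M.E \ Q) ?_ ?_ ?_
  · rintro Q ⟨⟨⟨hQE, hQcard, hQind, hQcind⟩, hyQ, hdep⟩, hfund⟩
    have hyR : y ∉ M.E \ Q := fun h => h.2 hyQ
    refine ⟨?_, ?_, ?_, hQcind, ?_⟩
    · intro x hx
      exact ⟨hx.1, fun h => hx.2 (Set.mem_singleton_iff.mp h ▸ hyQ)⟩
    · rw [Set.ncard_sdiff' hQE M.ground_finite, hQcard, hn]; omega
    · rw [← hfund]
      intro x hx
      rcases Set.mem_insert_iff.mp (M.fundCircuit_subset_insert y (M.E \ Q) hx.1) with h | h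
      · exact absurd h hx.2
      · exact h
    · rw [insert_sdiff_sdiff_eq M hyE hyR, Set.sdiff_sdiff_right_self, Set.inter_eq_right.mpr hQE]
      exact hQind
  · rintro Q Q' ⟨⟨⟨hQE, -, -, -⟩, -, -⟩, -⟩ ⟨⟨⟨hQ'E, -, -, -⟩, -, -⟩, -⟩ h
    have h1 : M.E \ (M.E \ Q) = M.E \ (M.E \ Q') := by rw [h]
    rwa [Set.sdiff_sdiff_right_self, Set.sdiff_sdiff_right_self, Set.inter_eq_right.mpr hQE,
      Set.inter_eq_right.mpr hQ'E] at h1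
  · rintro R ⟨hRE, hRcard, hCR, hRind, hRcind⟩
    have hyR : y ∉ R := fun h => (hRE h).2 rfl
    have hRE' : R ⊆ M.E := hRE.trans Set.sdiff_subset
    have hQeq : insert y ((M.E \ {y}) \ R) = M.E \ R := insert_sdiff_sdiff_eq M hyE hyR
    have hcompl : M.E \ (M.E \ R) = R := by
      rw [Set.sdiff_sdiff_right_self, Set.inter_eq_right.mpr hRE']
    have hCs : C ⊆ insert y R := by
      intro x hx
      by_cases hxy : x = y
      · exact Or.inl hxy
      · exact Or.inr (hCR ⟨hx, hxy⟩)
    refine ⟨M.E \ R, ⟨⟨⟨Set.sdiff_subset, ?_, ?_, ?_⟩, ⟨hyE, hyR⟩, ?_⟩, ?_⟩, hcompl⟩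
    · rw [Set.ncard_sdiff' hRE' M.ground_finite, hRcard, hn]; omega
    · rw [← hQeq]; exact hRcind
    · rw [hcompl]; exact hRind
    · rw [hcompl]
      exact fun hind => hC.dep.not_indep (hind.subset hCs)
    · rw [hcompl]
      exact (hC.eq_fundCircuit_of_subset hRind hCs).symm

/-- Every member of `highAbsorb` has the fundamental circuit of `y` in its complement among the circuits through `y`. -/
lemma fundCircuit_compl_mem_circuitsThrough {y : α} (hyE : y ∈ M.E) {j : ℕ} {Q : Set α}
    (hQ : Q ∈ highAbsorb M y j) : M.fundCircuit y (M.E \ Q) ∈ circuitsThrough M y := by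
  obtain ⟨⟨-, -, -, hQcind⟩, hyQ, hdep⟩ := hQ
  rw [mem_circuitsThrough]
  obtain ⟨h1, h2, -⟩ := fundCircuit_spec M hQcind (fun h => h.2 hyQ) hyE hdep
  exact ⟨h1, h2⟩

/-- **`#highAbsorb = Σ_{C ∋ y} ρ(C)`** (fibrewise by the fundamental circuit of `y` in the complement). -/
lemma ncard_highAbsorb_eq_sum {y : α} (hyE : y ∈ M.E) {j : ℕ} (hn : M.E.ncard = 2 * j + 2) :
    (highAbsorb M y j).ncard = ∑ C ∈ circuitsThrough M y, circuitHighCount M y C j := by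
  classical
  have hfin := highAbsorb_finite M y j
  rw [Set.ncard_eq_toFinset_card _ hfin]
  rw [Finset.card_eq_sum_card_fiberwise (f := fun Q => M.fundCircuit y (M.E \ Q)) (t := circuitsThrough M y)
    (fun Q hQ => fundCircuit_compl_mem_circuitsThrough M hyE (hfin.mem_toFinset.mp hQ))]
  refine Finset.sum_congr rfl (fun C hC => ?_)
  rw [mem_circuitsThrough] at hC
  rw [← ncard_highAbsorb_fibre M hyE hC.1 hn, ← Set.ncard_coe_finset]
  congr 1
  ext Q
  simp only [Finset.coe_filter, Set.Finite.mem_toFinset, Set.mem_setOf_eq]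

/-! ## The non-absorbing parts are in bijection -/

/-- The non-absorbing avoid-`y` sets at level `j`: `Z ∈ D_j`, `y ∉ Z`, `insert y Z` independent. -/
def lowFree (y : α) (j : ℕ) : Set (Set α) := {Z ∈ biIndep M j | y ∉ Z ∧ M.Indep (insert y Z)}

/-- The non-absorbing through-`y` sets at level `j + 1`: `Q ∈ D_{j+1}`, `y ∈ Q`, `insert y (E ∖ Q)` independent. -/
def highFree (y : α) (j : ℕ) : Set (Set α) := {Q ∈ biIndep M (j + 1) | y ∈ Q ∧ M.Indep (insert y (M.E \ Q))}

/-- **`#lowFree = #highFree`** (by `Z ↦ insert y Z`). -/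
lemma ncard_lowFree_eq_highFree {y : α} (hyE : y ∈ M.E) (j : ℕ) :
    (lowFree M y j).ncard = (highFree M y j).ncard := by
  refine Set.ncard_congr (fun Z _ => insert y Z) ?_ ?_ ?_
  · rintro Z ⟨⟨hZE, hZcard, hZind, hZcind⟩, hyZ, hind⟩
    have hZfin : Z.Finite := M.ground_finite.subset hZE
    have h1 : M.E \ insert y Z = (M.E \ Z) \ {y} := by
      ext x; simp only [Set.mem_sdiff, Set.mem_insert_iff, Set.mem_singleton_iff]; tauto
    have h2 : insert y ((M.E \ Z) \ {y}) = M.E \ Z :=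
      Set.insert_sdiff_self_of_mem ⟨hyE, hyZ⟩
    refine ⟨⟨Set.insert_subset hyE hZE, ?_, hind, ?_⟩, Set.mem_insert y Z, ?_⟩
    · rw [Set.ncard_insert_of_notMem hyZ hZfin, hZcard]
    · rw [h1]; exact hZcind.subset Set.sdiff_subset
    · rw [h1, h2]; exact hZcind
  · rintro Z Z' ⟨-, hyZ, -⟩ ⟨-, hyZ', -⟩ h
    rw [← Set.insert_sdiff_self_of_notMem hyZ, ← Set.insert_sdiff_self_of_notMem hyZ', h]
  · rintro Q ⟨⟨hQE, hQcard, hQind, hQcind⟩, hyQ, hind⟩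
    have hQfin : Q.Finite := M.ground_finite.subset hQE
    have h1 : M.E \ (Q \ {y}) = insert y (M.E \ Q) := by
      ext x; simp only [Set.mem_sdiff, Set.mem_insert_iff, Set.mem_singleton_iff]
      constructor
      · rintro ⟨hxE, hx⟩
        by_cases hxy : x = y
        · exact Or.inl hxy
        · exact Or.inr ⟨hxE, fun hxQ => hx ⟨hxQ, hxy⟩⟩
      · rintro (rfl | ⟨hxE, hxQ⟩)
        · exact ⟨hyE, fun h => h.2 rfl⟩
        · exact ⟨hxE, fun h => hxQ h.1⟩
    refine ⟨Q \ {y}, ⟨⟨Set.sdiff_subset.trans hQE, ?_, hQind.subset Set.sdiff_subset, ?_⟩, ?_, ?_⟩,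
      Set.insert_sdiff_self_of_mem hyQ⟩
    · rw [Set.ncard_sdiff_singleton_of_mem hyQ, hQcard]; rfl
    · rw [h1]; exact hind
    · exact fun h => h.2 rfl
    · rw [Set.insert_sdiff_self_of_mem hyQ]; exact hQind

/-! ## The bridge -/

/-- **(PC) IMPLIES (★★) AT THE LAST LEVEL BELOW THE MIDDLE**: for `#E = 2j + 2` and `y ∈ E`,
`#{Z ∈ D_j : y ∉ Z} ≤ #{Q ∈ D_{j+1} : y ∈ Q}`. -/
theorem perElemMid_of_perCircuit (h : PerCircuitMid M) {y : α} (hyE : y ∈ M.E) {j : ℕ}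
    (hn : M.E.ncard = 2 * j + 2) :
    {Z ∈ biIndep M j | y ∉ Z}.ncard ≤ {Q ∈ biIndep M (j + 1) | y ∈ Q}.ncard := by
  have hsplitL := ncard_split_pred {Z ∈ biIndep M j | y ∉ Z}
    ((biIndep_finite M j).subset (fun _ h => h.1)) (fun Z => M.Indep (insert y Z))
  have hsplitR := ncard_split_pred {Q ∈ biIndep M (j + 1) | y ∈ Q}
    ((biIndep_finite M (j + 1)).subset (fun _ h => h.1)) (fun Q => M.Indep (insert y (M.E \ Q)))
  have hL1 : {S ∈ {Z ∈ biIndep M j | y ∉ Z} | M.Indep (insert y S)} = lowFree M y j := by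
    ext Z; simp only [lowFree, Set.mem_setOf_eq, and_assoc]
  have hL2 : {S ∈ {Z ∈ biIndep M j | y ∉ Z} | ¬ M.Indep (insert y S)} = lowAbsorb M y j := by
    ext Z; simp only [lowAbsorb, Set.mem_setOf_eq, and_assoc]
  have hR1 : {S ∈ {Q ∈ biIndep M (j + 1) | y ∈ Q} | M.Indep (insert y (M.E \ S))} = highFree M y j := by
    ext Q; simp only [highFree, Set.mem_setOf_eq, and_assoc]
  have hR2 : {S ∈ {Q ∈ biIndep M (j + 1) | y ∈ Q} | ¬ M.Indep (insert y (M.E \ S))} = highAbsorb M y j := by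
    ext Q; simp only [highAbsorb, Set.mem_setOf_eq, and_assoc]
  rw [hsplitL, hsplitR, hL1, hL2, hR1, hR2, ncard_lowFree_eq_highFree M hyE j, ncard_lowAbsorb_eq_sum M hyE j,
    ncard_highAbsorb_eq_sum M hyE hn]
  refine Nat.add_le_add_left (Finset.sum_le_sum (fun C hC => ?_)) _
  rw [mem_circuitsThrough] at hC
  exact h y hyE C hC.1 hC.2 j hn

end PercRepro
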